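import Summits.Ventures.Crystal3D.Bulk.RotSysFaceGlue
import HarnessLib

/-!
# The walk of a face: iterates of the face permutation below the minimal period, and the walk
# of the MERGED face after deleting a non-separating edge (generic brick for LEMMA L — faces of
# the tight map are convex — by edge-insertion induction, `HOME/lean/lemmaL/DESIGN.md` R1.7′)

HONEST FRAMING. Part of the venture `Summits/Ventures/Crystal3D` (cell `pub-crystal3d`, phase 2;
seat typer-bulk-2), PURELY COMBINATORIAL and generic (folklore): no geometry, no configuration,
nothing about GAP(1.26). For a loopless rotation system `(σ, α)` (`Bulk/RotSysCounts.lean`), an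
`α`-closed dart set `S ∋ d`, `φ = phi σ α S`, the deleted edge `e = {d, α d}` and
`φ' = phi σ α (S ∖ e)`:

* `card_face_eq_minimalPeriod` — the face of `x ∈ S` (`Bulk/RotSysCorners.lean`, a finset) has
  exactly `minimalPeriod φ x` darts, namely `x, φ x, …, φ^(n−1) x` (`face_eq_image_range`);
  `IsRotSys.two_le_minimalPeriod_phi` (no face of length one);
* **the merged walk** (MERGE case, `d` and `α d` on different faces of `S`, periods
  `k = minimalPeriod φ d`, `m = minimalPeriod φ (α d)`): starting from `φ d`, the face
  permutation `φ'` of `S ∖ e` runs through `φ d, φ² d, …, φ^(k−1) d` (`phi_sdiff_pow_apply_left`),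
  then jumps to `φ (α d)` (`phi_sdiff_pow_apply_bridge`), runs through
  `φ (α d), …, φ^(m−1) (α d)` (`phi_sdiff_pow_apply_right`) and closes up after `k + m − 2` steps
  (`phi_sdiff_pow_apply_close`), which IS its minimal period (`minimalPeriod_phi_sdiff_merge`);
* **untouched faces**: on a face of `S` through neither `d` nor `α d` the powers of `φ'` and `φ`
  agree and so do the minimal periods (`phi_sdiff_pow_apply_of_not_sameCycle`,
  `minimalPeriod_phi_sdiff_of_not_sameCycle`);

The remaining combinatorial steps of the edge-insertion induction for LEMMA L (the MERGE
criterion from the Euler characteristic, corners and connectivity under insertion) are in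
`Bulk/RotSysInsertEdge.lean`; the induction itself in `Bulk/RotSysConvexFaces.lean`: insert the
missing hull edges one at a time; each insertion is read backwards as a MERGE, and two convex
faces glued along the inserted edge stay convex.
-/

namespace Summit.Ventures.Crystal3D

namespace RotSys

open Equiv Equiv.Perm Finset Function

variable {D : Type*} [DecidableEq D] [Fintype D]

/-! ## Faces and minimal periods -/

section Period

open scoped Classical

variable {σ α : Perm D} {S : Finset D}

omit [DecidableEq D] [Fintype D] in
/-- For a permutation, `(π ^ minimalPeriod π x) x = x`. -/
theorem pow_minimalPeriod_apply (π : Perm D) (x : D) : (π ^ minimalPeriod π x) x = x := by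
  have h := iterate_minimalPeriod (f := π) (x := x)
  rwa [Equiv.Perm.iterate_eq_pow] at h

omit [DecidableEq D] [Fintype D] in
/-- Below the minimal period the orbit does not return to its start. -/
theorem pow_apply_ne_self_of_lt (π : Perm D) {x : D} {i : ℕ} (hi0 : 0 < i)
    (hi : i < minimalPeriod π x) : (π ^ i) x ≠ x := by
  intro he
  have hper : IsPeriodicPt π i x := by
    unfold IsPeriodicPt IsFixedPt
    rw [Equiv.Perm.iterate_eq_pow]
    exact he
  have := hper.minimalPeriod_le hi0
  omega

omit [DecidableEq D] [Fintype D] in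
/-- Powers of a permutation at `x` only depend on the exponent modulo the minimal period. -/
theorem pow_mod_minimalPeriod_apply (π : Perm D) (x : D) (n : ℕ) :
    (π ^ (n % minimalPeriod π x)) x = (π ^ n) x := by
  have h := iterate_mod_minimalPeriod_eq (f := π) (x := x) (n := n)
  rwa [Equiv.Perm.iterate_eq_pow, Equiv.Perm.iterate_eq_pow] at h

/-- **The face of `x ∈ S` is the orbit below the minimal period**:
`face σ α S x = {x, φ x, …, φ^(n−1) x}`, `n = minimalPeriod φ x`. -/
theorem face_eq_image_range (hS : IsClosed α S) {x : D} (hx : x ∈ S) :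
    face σ α S x =
      (range (minimalPeriod (phi σ α S) x)).image fun i => (phi σ α S ^ i) x := by
  ext y
  rw [mem_face, mem_image]
  constructor
  · rintro ⟨-, hc⟩
    obtain ⟨i, hi, he⟩ := SameCycle.exists_lt_minimalPeriod hc
    exact ⟨i, mem_range.2 hi, he⟩
  · rintro ⟨i, -, rfl⟩
    exact ⟨phi_pow_apply_mem hS hx i, ⟨i, by rw [zpow_natCast]⟩⟩

/-- **A face has `minimalPeriod` darts.** -/
theorem card_face_eq_minimalPeriod (hS : IsClosed α S) {x : D} (hx : x ∈ S) :
    (face σ α S x).card = minimalPeriod (phi σ α S) x := by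
  rw [face_eq_image_range hS hx, card_image_of_injOn, card_range]
  intro m hm n hn hmn
  rw [coe_range, Set.mem_Iio] at hm hn
  have hmn' : (phi σ α S)^[m] x = (phi σ α S)^[n] x := by
    rw [Equiv.Perm.iterate_eq_pow, Equiv.Perm.iterate_eq_pow]; exact hmn
  exact iterate_injOn_Iio_minimalPeriod hm hn hmn'

/-- **No face of length one**: every dart has minimal period `≥ 2` under the face permutation
of a loopless rotation system. -/
theorem IsRotSys.two_le_minimalPeriod_phi (h : IsRotSys σ α) (S : Finset D) (x : D) :
    2 ≤ minimalPeriod (phi σ α S) x := by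
  have h1 : 0 < minimalPeriod (phi σ α S) x := minimalPeriod_pos_perm _ x
  by_contra hlt
  have he : minimalPeriod (phi σ α S) x = 1 := by omega
  have := pow_minimalPeriod_apply (phi σ α S) x
  rw [he, pow_one] at this
  exact h.phi_ne_self S x this

/-- Darts on one face have the same minimal period. -/
theorem minimalPeriod_eq_of_sameCycle (hS : IsClosed α S) {x y : D} (hx : x ∈ S)
    (hxy : (phi σ α S).SameCycle x y) :
    minimalPeriod (phi σ α S) y = minimalPeriod (phi σ α S) x := by
  have hy : y ∈ S := by
    obtain ⟨n, hn⟩ := hxy.exists_nat_pow_eq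
    rw [← hn]; exact phi_pow_apply_mem hS hx n
  rw [← card_face_eq_minimalPeriod hS hx, ← card_face_eq_minimalPeriod hS hy,
    face_eq_of_sameCycle hxy]

end Period

/-! ## The walk of the merged face -/

section MergeWalk

open scoped Classical

variable {σ α : Perm D} {S : Finset D} {d : D}

/-- In the MERGE case, the darts `φ^i d`, `0 < i < k`, survive the deletion of `{d, α d}`. -/
theorem pow_phi_mem_sdiff_of_not_sameCycle (hS : IsClosed α S) (hd : d ∈ S)
    (hdiff : ¬ (phi σ α S).SameCycle d (α d)) {i : ℕ} (hi0 : 0 < i)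
    (hi : i < minimalPeriod (phi σ α S) d) : (phi σ α S ^ i) d ∈ S \ {d, α d} := by
  refine mem_sdiff_pair_iff.2 ⟨phi_pow_apply_mem hS hd i, pow_apply_ne_self_of_lt _ hi0 hi, ?_⟩
  intro he
  exact hdiff ⟨i, by rw [zpow_natCast, he]⟩

/-- … and so do the darts `φ^j (α d)`, `0 < j < m`. -/
theorem pow_phi_alpha_mem_sdiff_of_not_sameCycle (h : IsRotSys σ α) (hS : IsClosed α S)
    (hd : d ∈ S) (hdiff : ¬ (phi σ α S).SameCycle d (α d)) {j : ℕ} (hj0 : 0 < j)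
    (hj : j < minimalPeriod (phi σ α S) (α d)) : (phi σ α S ^ j) (α d) ∈ S \ {d, α d} := by
  have key := pow_phi_mem_sdiff_of_not_sameCycle (d := α d) hS (hS d hd)
    (by rw [h.α_inv]; exact fun hc => hdiff hc.symm) hj0 hj
  rw [h.α_inv, pair_comm] at key
  exact key

/-- **The merged walk, left run.** In the MERGE case, starting from `φ d` the face permutation
of `S ∖ {d, α d}` follows `φ` for `k − 2` steps: `φ'^i (φ d) = φ^(i+1) d` for `i + 1 < k`. -/
theorem IsRotSys.phi_sdiff_pow_apply_left (h : IsRotSys σ α) (hS : IsClosed α S) (hd : d ∈ S)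
    (hdiff : ¬ (phi σ α S).SameCycle d (α d)) :
    ∀ i : ℕ, i + 1 < minimalPeriod (phi σ α S) d →
      (phi σ α (S \ {d, α d}) ^ i) (phi σ α S d) = (phi σ α S ^ (i + 1)) d := by
  intro i
  induction i with
  | zero => intro _; rw [pow_zero, Perm.one_apply, zero_add, pow_one]
  | succ i ih =>
    intro hi
    have hx : (phi σ α S ^ (i + 1)) d ∈ S \ {d, α d} :=
      pow_phi_mem_sdiff_of_not_sameCycle hS hd hdiff (Nat.succ_pos i) (by omega)
    have hnext : phi σ α S ((phi σ α S ^ (i + 1)) d) = (phi σ α S ^ (i + 2)) d := by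
      rw [← Perm.mul_apply, ← pow_succ']
    have h1 : phi σ α S ((phi σ α S ^ (i + 1)) d) ≠ d := by
      rw [hnext]; exact pow_apply_ne_self_of_lt _ (by omega) hi
    have h2 : phi σ α S ((phi σ α S ^ (i + 1)) d) ≠ α d := by
      rw [hnext]; intro he; exact hdiff ⟨(i + 2 : ℕ), by rw [zpow_natCast, he]⟩
    rw [pow_succ', Perm.mul_apply, ih (by omega), h.phi_sdiff_apply_of_ne hS hd hx h1 h2, hnext]

/-- **The merged walk, the bridge.** After the left run the walk jumps to the face of `α d`:
`φ'^(k−1) (φ d) = φ (α d)`. -/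
theorem IsRotSys.phi_sdiff_pow_apply_bridge (h : IsRotSys σ α) (hS : IsClosed α S) (hd : d ∈ S)
    (hdiff : ¬ (phi σ α S).SameCycle d (α d)) :
    (phi σ α (S \ {d, α d}) ^ (minimalPeriod (phi σ α S) d - 1)) (phi σ α S d) =
      phi σ α S (α d) := by
  have hk := h.two_le_minimalPeriod_phi S d
  set k := minimalPeriod (phi σ α S) d with hk_def
  have hx : (phi σ α S ^ (k - 1)) d ∈ S \ {d, α d} :=
    pow_phi_mem_sdiff_of_not_sameCycle hS hd hdiff (by omega) (by omega)
  have hback : phi σ α S ((phi σ α S ^ (k - 1)) d) = d := by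
    rw [← Perm.mul_apply, ← pow_succ', Nat.sub_add_cancel (by omega : 1 ≤ k), hk_def,
      pow_minimalPeriod_apply]
  have e : k - 1 = (k - 2) + 1 := by omega
  rw [e, pow_succ', Perm.mul_apply, h.phi_sdiff_pow_apply_left hS hd hdiff (k - 2) (by omega),
    show k - 2 + 1 = k - 1 by omega, h.phi_sdiff_apply hS hd hx, if_pos hback]

/-- **The merged walk, right run.** Then it follows the face of `α d`:
`φ'^(k−1+j) (φ d) = φ^(j+1) (α d)` for `j + 1 < m`. -/
theorem IsRotSys.phi_sdiff_pow_apply_right (h : IsRotSys σ α) (hS : IsClosed α S) (hd : d ∈ S)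
    (hdiff : ¬ (phi σ α S).SameCycle d (α d)) :
    ∀ j : ℕ, j + 1 < minimalPeriod (phi σ α S) (α d) →
      (phi σ α (S \ {d, α d}) ^ (minimalPeriod (phi σ α S) d - 1 + j)) (phi σ α S d) =
        (phi σ α S ^ (j + 1)) (α d) := by
  intro j
  induction j with
  | zero =>
    intro _
    rw [add_zero, zero_add, pow_one]
    exact h.phi_sdiff_pow_apply_bridge hS hd hdiff
  | succ j ih =>
    intro hj
    have hx : (phi σ α S ^ (j + 1)) (α d) ∈ S \ {d, α d} :=
      pow_phi_alpha_mem_sdiff_of_not_sameCycle h hS hd hdiff (Nat.succ_pos j) (by omega)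
    have hnext : phi σ α S ((phi σ α S ^ (j + 1)) (α d)) = (phi σ α S ^ (j + 2)) (α d) := by
      rw [← Perm.mul_apply, ← pow_succ']
    have h1 : phi σ α S ((phi σ α S ^ (j + 1)) (α d)) ≠ d := by
      rw [hnext]; intro he
      exact hdiff (SameCycle.symm ⟨(j + 2 : ℕ), by rw [zpow_natCast, he]⟩)
    have h2 : phi σ α S ((phi σ α S ^ (j + 1)) (α d)) ≠ α d := by
      rw [hnext]; exact pow_apply_ne_self_of_lt _ (by omega) hj
    rw [← add_assoc, pow_succ', Perm.mul_apply, ih (by omega),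
      h.phi_sdiff_apply_of_ne hS hd hx h1 h2, hnext]

/-- **The merged walk closes up after `k + m − 2` steps**: `φ'^(k+m−2) (φ d) = φ d`. -/
theorem IsRotSys.phi_sdiff_pow_apply_close (h : IsRotSys σ α) (hS : IsClosed α S) (hd : d ∈ S)
    (hdiff : ¬ (phi σ α S).SameCycle d (α d)) :
    (phi σ α (S \ {d, α d}) ^
        (minimalPeriod (phi σ α S) d + minimalPeriod (phi σ α S) (α d) - 2)) (phi σ α S d) =
      phi σ α S d := by
  have hk := h.two_le_minimalPeriod_phi S d
  have hm := h.two_le_minimalPeriod_phi S (α d)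
  set k := minimalPeriod (phi σ α S) d with hk_def
  set m := minimalPeriod (phi σ α S) (α d) with hm_def
  have hx : (phi σ α S ^ (m - 1)) (α d) ∈ S \ {d, α d} :=
    pow_phi_alpha_mem_sdiff_of_not_sameCycle h hS hd hdiff (by omega) (by omega)
  have hback : phi σ α S ((phi σ α S ^ (m - 1)) (α d)) = α d := by
    rw [← Perm.mul_apply, ← pow_succ', Nat.sub_add_cancel (by omega : 1 ≤ m), hm_def,
      pow_minimalPeriod_apply]
  have hne : phi σ α S ((phi σ α S ^ (m - 1)) (α d)) ≠ d := by
    rw [hback]; exact h.α_ne d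
  have e : k + m - 2 = (k - 1 + (m - 2)) + 1 := by omega
  rw [e, pow_succ', Perm.mul_apply, h.phi_sdiff_pow_apply_right hS hd hdiff (m - 2) (by omega),
    show m - 2 + 1 = m - 1 by omega, h.phi_sdiff_apply hS hd hx, if_neg hne, if_pos hback]

/-- **The merged walk in one formula**: for `i < k + m − 2`,
`φ'^i (φ d) = φ^(i+1) d` if `i + 1 < k`, and `= φ^(i+2−k) (α d)` otherwise. -/
theorem IsRotSys.phi_sdiff_pow_apply_merge (h : IsRotSys σ α) (hS : IsClosed α S) (hd : d ∈ S)
    (hdiff : ¬ (phi σ α S).SameCycle d (α d)) {i : ℕ}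
    (hi : i < minimalPeriod (phi σ α S) d + minimalPeriod (phi σ α S) (α d) - 2) :
    (phi σ α (S \ {d, α d}) ^ i) (phi σ α S d) =
      if i + 1 < minimalPeriod (phi σ α S) d then (phi σ α S ^ (i + 1)) d
      else (phi σ α S ^ (i + 2 - minimalPeriod (phi σ α S) d)) (α d) := by
  have hk := h.two_le_minimalPeriod_phi S d
  set k := minimalPeriod (phi σ α S) d with hk_def
  split_ifs with hlt
  · exact h.phi_sdiff_pow_apply_left hS hd hdiff i hlt
  · have e : i = k - 1 + (i + 1 - k) := by omega
    rw [e, h.phi_sdiff_pow_apply_right hS hd hdiff (i + 1 - k) (by omega)]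
    congr 2
    omega

/-- `φ d` lies on the merged face `U = (face d ∪ face (α d)) ∖ {d, α d}`. -/
theorem IsRotSys.phi_mem_U (h : IsRotSys σ α) (hS : IsClosed α S) (hd : d ∈ S)
    (hdiff : ¬ (phi σ α S).SameCycle d (α d)) :
    phi σ α S d ∈ (face σ α S d ∪ face σ α S (α d)) \ {d, α d} := by
  have hk := h.two_le_minimalPeriod_phi S d
  have hx : (phi σ α S ^ 1) d ∈ S \ {d, α d} :=
    pow_phi_mem_sdiff_of_not_sameCycle hS hd hdiff Nat.one_pos (by omega)
  rw [pow_one] at hx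
  exact mem_U_iff.2 ⟨hx, Or.inl ⟨1, by rw [zpow_one]⟩⟩

/-- **The merged face has `k + m − 2` darts**, i.e. the minimal period of `φ d` under the face
permutation of `S ∖ {d, α d}` is `minimalPeriod φ d + minimalPeriod φ (α d) − 2`. -/
theorem IsRotSys.minimalPeriod_phi_sdiff_merge (h : IsRotSys σ α) (hS : IsClosed α S)
    (hd : d ∈ S) (hdiff : ¬ (phi σ α S).SameCycle d (α d)) :
    minimalPeriod (phi σ α (S \ {d, α d})) (phi σ α S d) =
      minimalPeriod (phi σ α S) d + minimalPeriod (phi σ α S) (α d) - 2 := by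
  have hαd : α d ∈ S := hS d hd
  have hne : α d ≠ d := h.α_ne d
  have hq := h.phi_mem_U hS hd hdiff
  have hU := h.face_sdiff_eq_U_of_merge hS hd hdiff hq
  rw [← card_face_eq_minimalPeriod (isClosed_sdiff_pair h hS d) (mem_U_iff.1 hq).1, hU,
    ← card_face_eq_minimalPeriod hS hd, ← card_face_eq_minimalPeriod hS hαd]
  have hdisj : Disjoint (face σ α S d) (face σ α S (α d)) := by
    rw [Finset.disjoint_left]
    intro y hy hy'
    exact hdiff ((mem_face.1 hy).2.trans (mem_face.1 hy').2.symm)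
  have hpair : ({d, α d} : Finset D) ⊆ face σ α S d ∪ face σ α S (α d) := by
    intro x hx
    rw [mem_insert, mem_singleton] at hx
    rcases hx with rfl | rfl
    · exact mem_union_left _ (mem_face_self hd)
    · exact mem_union_right _ (mem_face_self hαd)
  rw [card_sdiff_of_subset hpair, card_union_of_disjoint hdisj, card_pair hne.symm]

end MergeWalk

/-! ## Untouched faces -/

section Untouched

open scoped Classical

variable {σ α : Perm D} {S : Finset D} {d : D}

/-- **On a face of `S` through neither `d` nor `α d` the powers of the two face permutations
agree.** -/
theorem IsRotSys.phi_sdiff_pow_apply_of_not_sameCycle (h : IsRotSys σ α) (hS : IsClosed α S)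
    (hd : d ∈ S) {y : D} (hy : y ∈ S) (hyd : ¬ (phi σ α S).SameCycle d y)
    (hyα : ¬ (phi σ α S).SameCycle (α d) y) (n : ℕ) :
    (phi σ α (S \ {d, α d}) ^ n) y = (phi σ α S ^ n) y := by
  -- on the face `T` of `y` in `S`, `φ'` and `φ` agree and `φ` preserves `T`
  have hTmem : ∀ z ∈ face σ α S y, z ∈ S \ {d, α d} := by
    intro z hz
    obtain ⟨hzS, hc⟩ := mem_face.1 hz
    refine mem_sdiff_pair_iff.2 ⟨hzS, ?_, ?_⟩
    · rintro rfl; exact hyd hc.symm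
    · rintro rfl; exact hyα hc.symm
  have hfg : ∀ z ∈ face σ α S y, phi σ α (S \ {d, α d}) z = phi σ α S z := by
    intro z hz
    obtain ⟨-, hc⟩ := mem_face.1 hz
    have hc' : (phi σ α S).SameCycle y (phi σ α S z) := hc.trans ⟨1, by simp⟩
    exact h.phi_sdiff_apply_of_ne hS hd (hTmem z hz)
      (fun e => hyd (by rw [← e]; exact hc'.symm)) (fun e => hyα (by rw [← e]; exact hc'.symm))
  have hg : ∀ z ∈ face σ α S y, phi σ α S z ∈ face σ α S y := fun z hz =>
    mem_face.2 ⟨phi_apply_mem hS (mem_face.1 hz).1, (mem_face.1 hz).2.trans ⟨1, by simp⟩⟩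
  have hf : ∀ z ∈ face σ α S y, phi σ α (S \ {d, α d}) z ∈ face σ α S y := fun z hz => by
    rw [hfg z hz]; exact hg z hz
  exact (pow_apply_eq_of_eqOn hfg hf (mem_face_self hy) n).1

/-- … and so do the minimal periods. -/
theorem IsRotSys.minimalPeriod_phi_sdiff_of_not_sameCycle (h : IsRotSys σ α)
    (hS : IsClosed α S) (hd : d ∈ S) {y : D} (hy : y ∈ S) (hyd : ¬ (phi σ α S).SameCycle d y)
    (hyα : ¬ (phi σ α S).SameCycle (α d) y) :
    minimalPeriod (phi σ α (S \ {d, α d})) y = minimalPeriod (phi σ α S) y := by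
  have hy' : y ∈ S \ {d, α d} := by
    refine mem_sdiff_pair_iff.2 ⟨hy, ?_, ?_⟩
    · rintro rfl; exact hyd (SameCycle.refl _ _)
    · rintro rfl; exact hyα (SameCycle.refl _ _)
  rw [← card_face_eq_minimalPeriod (isClosed_sdiff_pair h hS d) hy',
    ← card_face_eq_minimalPeriod hS hy, h.face_sdiff_of_not_sameCycle hS hd hy hyd hyα]

end Untouched

end RotSys

end Summit.Ventures.Crystal3D
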